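import Summits.Ventures.HSemireg.WedgeHankelRecurrenceGaussChebyshevLocalExtrema

/-!
# Venture HSemireg — **CHARACTERISATION OF THE EXTREMA OF `C_n`: for `n ≥ 2`, `x` is a local extremum of `C_n` on `ℝ` iff `x = 2cos(kπ∕n)` for some `0 < k < n`; for `n ≠ 0` and `x ∈ [−2, 2]`, `x` is an
# extremum of `C_n` on `[−2, 2]` iff `x = 2cos(kπ∕n)` for some `k ≤ n`** (transport of Mathlib's `isLocalExtr_T_real_iff` and `isExtrOn_T_real_iff` along `C_n(2y) = 2T_n(y)`, with the converse
# directions supplied by N547)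

HONEST FRAMING. Part of the Lean index of the computation cell `pub-hsemireg` (seat p10 gen 49, Sunday typer «UNIFORM-IN-n»).  Real analysis of polynomial functions only (Mathlib `IsLocalExtr ∕ IsExtrOn`,
`Polynomial.Chebyshev.T ∕ C` over `ℝ`); no variety, no cohomology theory, no sheaf, no Ext group and no semiregularity map is constructed here; nothing here says that HC / HC_CM / HC_AV holds; no
Literature fact (unproved `Prop`) is declared or used.  Custodian versions as in `WedgeHankelSiegelIdeal` (1/3).
SOURCES (cited).  T. J. Rivlin, *The Chebyshev Polynomials* (Wiley 1974), §1.2, §2.7 (the `n − 1` interior extrema `cos(kπ∕n)` of `T_n` and the `n + 1` points of equioscillation); NIST DLMF §18.14(i).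
PROOF TYPED HERE.  (→) `y ↦ 2y` is continuous with `2·(x∕2) = x`, so a local extremum of `C_n` at `x` pulls back (`IsLocalExtr.comp_continuous`) to one of `y ↦ C_n(2y) = 2T_n(y)` at `x∕2`, hence
(monotone `·∕2`, `IsLocalExtr.comp_mono`) of `T_n`; Mathlib `isLocalExtr_T_real_iff` gives `x∕2 = cos(kπ∕n)`; the `IsExtrOn` version is pointwise.  (←) N547 `isLocalMax ∕ isLocalMin ∕ isMaxOn ∕
isMinOn_chebyshevC_real` by the parity of `k`.
DEDUP DISCLOSURE (`rg -n 'IsLocalExtr|IsExtrOn' Summits/Ventures/HSemireg -g 'WedgeHankelRecurrenceGaussChebyshev*'` — none, 2026-09-04): Mathlib has the `T_n` characterisations (USED); N547 the one-directional `C_n`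
statements; the `C_n` characterisations are not typed; 0 hits for the 3 names below.

WHAT IS IN THE TREE.  N547 `isLocalMax_chebyshevC_real`, `isLocalMin_chebyshevC_real`, `isMaxOn_chebyshevC_real`, `isMinOn_chebyshevC_real`; Mathlib `isLocalExtr_T_real_iff`, `isExtrOn_T_real_iff`,
`IsLocalExtr.comp_continuous`, `IsLocalExtr.comp_mono`, `C_comp_two_mul_X`, `Nat.even_or_odd`.
THIS FILE (namespace `Summit.Ventures.HSemireg.Wedge.HankelOuter` continued; CHAINED on N547; 0 definitions):
* §1313 `chebyshevC_eval_two_mul` (`C_n(2y) = 2T_n(y)`), **`isLocalExtr_chebyshevC_real_iff`** (`n ≥ 2`: `IsLocalExtr C_n x ↔ ∃ k ∈ (0, n), x = 2cos(kπ∕n)`), **`isExtrOn_chebyshevC_real_iff`**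
  (`n ≠ 0`, `x ∈ [−2, 2]`: `IsExtrOn C_n [−2,2] x ↔ ∃ k ≤ n, x = 2cos(kπ∕n)`).
CAVEATS.  `n ∈ ℕ`.  Nothing Ext-side.  New names only.
-/

open Module Polynomial
open scoped Matrix Polynomial Topology

namespace Summit.Ventures.HSemireg.Wedge.HankelOuter

/-! ## §1313. `IsLocalExtr` ∕ `IsExtrOn` characterisations for `C_n` -/

/-- `C_n(2y) = 2T_n(y)` (Mathlib `C_comp_two_mul_X` evaluated). [this file, §1313] -/
theorem chebyshevC_eval_two_mul {R : Type*} [CommRing R] (n : ℤ) (y : R) :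
    (Polynomial.Chebyshev.C R n).eval (2 * y) = 2 * (Polynomial.Chebyshev.T R n).eval y := by
  have h := congrArg (Polynomial.eval y) (Polynomial.Chebyshev.C_comp_two_mul_X R n)
  simp only [eval_comp, eval_mul, eval_ofNat, eval_X] at h
  exact h

/-- **For `n ≥ 2`: `x` is a local extremum of `C_n` iff `x = 2cos(kπ∕n)` for some `0 < k < n`.** [Rivlin 1974, §1.2; this file, §1313] -/
theorem isLocalExtr_chebyshevC_real_iff {n : ℕ} (hn : 2 ≤ n) (x : ℝ) :
    IsLocalExtr (fun x : ℝ => (Polynomial.Chebyshev.C ℝ (n : ℤ)).eval x) x ↔ ∃ k ∈ Finset.Ioo 0 n, x = 2 * Real.cos (k * Real.pi / n) := by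
  constructor
  · intro h
    have h1 : IsLocalExtr ((fun x : ℝ => (Polynomial.Chebyshev.C ℝ (n : ℤ)).eval x) ∘ fun y : ℝ => 2 * y) (x / 2) :=
      IsLocalExtr.comp_continuous (by rwa [show 2 * (x / 2) = x by ring]) (continuous_const.mul continuous_id).continuousAt
    have h2 := h1.comp_mono (g := fun z : ℝ => z / 2) (fun a b hab => by simp only; linarith)
    have h3 : IsLocalExtr (Polynomial.Chebyshev.T ℝ n).eval (x / 2) := by
      refine (show (Polynomial.Chebyshev.T ℝ (n : ℤ)).eval = (fun z : ℝ => z / 2) ∘ ((fun x : ℝ => (Polynomial.Chebyshev.C ℝ (n : ℤ)).eval x) ∘ fun y : ℝ => 2 * y) from ?_) ▸ h2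
      funext y
      simp only [Function.comp_apply, chebyshevC_eval_two_mul]
      ring
    obtain ⟨k, hk, hxk⟩ := (Polynomial.Chebyshev.isLocalExtr_T_real_iff hn (x / 2)).mp h3
    exact ⟨k, hk, by linarith⟩
  · rintro ⟨k, hk, rfl⟩
    rw [Finset.mem_Ioo] at hk
    have hn0 : n ≠ 0 := by omega
    rcases Nat.even_or_odd k with he | ho
    · exact Or.inr (isLocalMax_chebyshevC_real hn0 hk.1 hk.2 he)
    · exact Or.inl (isLocalMin_chebyshevC_real hn0 hk.2 ho)

/-- **For `n ≠ 0` and `x ∈ [−2, 2]`: `x` is an extremum of `C_n` on `[−2, 2]` iff `x = 2cos(kπ∕n)` for some `k ≤ n`** (the `n + 1` points of equioscillation). [Rivlin 1974, §2.7; this file, §1313] -/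
theorem isExtrOn_chebyshevC_real_iff {n : ℕ} (hn : n ≠ 0) {x : ℝ} (hx : x ∈ Set.Icc (-2 : ℝ) 2) :
    IsExtrOn (fun x : ℝ => (Polynomial.Chebyshev.C ℝ (n : ℤ)).eval x) (Set.Icc (-2) 2) x ↔ ∃ k ≤ n, x = 2 * Real.cos (k * Real.pi / n) := by
  have hx' : x / 2 ∈ Set.Icc (-1 : ℝ) 1 := ⟨by linarith [hx.1], by linarith [hx.2]⟩
  constructor
  · intro h
    have hT : IsExtrOn (Polynomial.Chebyshev.T ℝ n).eval (Set.Icc (-1) 1) (x / 2) := by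
      rcases h with hmin | hmax
      · refine Or.inl fun z hz => ?_
        have hz' : 2 * z ∈ Set.Icc (-2 : ℝ) 2 := ⟨by linarith [hz.1], by linarith [hz.2]⟩
        have h1 := hmin hz'
        simp only [Set.mem_setOf_eq] at h1 ⊢
        rw [chebyshevC_eval_two_mul, show x = 2 * (x / 2) by ring, chebyshevC_eval_two_mul] at h1
        linarith
      · refine Or.inr fun z hz => ?_
        have hz' : 2 * z ∈ Set.Icc (-2 : ℝ) 2 := ⟨by linarith [hz.1], by linarith [hz.2]⟩
        have h1 := hmax hz'
        simp only [Set.mem_setOf_eq] at h1 ⊢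
        rw [chebyshevC_eval_two_mul, show x = 2 * (x / 2) by ring, chebyshevC_eval_two_mul] at h1
        linarith
    obtain ⟨k, hk, hxk⟩ := (Polynomial.Chebyshev.isExtrOn_T_real_iff hn hx').mp hT
    exact ⟨k, hk, by linarith⟩
  · rintro ⟨k, hk, rfl⟩
    rcases Nat.even_or_odd k with he | ho
    · exact Or.inr (isMaxOn_chebyshevC_real hn hk he)
    · exact Or.inl (isMinOn_chebyshevC_real hn hk ho)

end Summit.Ventures.HSemireg.Wedge.HankelOuter
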